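import Summits.AtomisticToContinuum.BoseEinsteinCondensation.Theorems.BECConjugateDominationHardCoreExtensionBoundedPositiveMinimiserHolds
import Literature.MathematicalPhysics.QuantumManyBody.PeriodicFeynmanKacCell
import Literature.MathematicalPhysics.QuantumManyBody.PeriodicMaxFormSimplicity
import Literature.MathematicalPhysics.QuantumManyBody.PeriodicClusteringFromKyFanGap
import Literature.MathematicalPhysics.QuantumManyBody.CondensateOccupationStability
import Literature.MathematicalPhysics.QuantumManyBody.PeriodicKineticBudget
import HarnessLib

/-!
# (α'_int): for INTEGRABLE potentials the Feynman–Kac minimisers of the truncations are near-minimisers of `v`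
# (line `third-law-current-floor`, crux `HardCoreExtension`, stmt-AtomisticToContinuum-11786, lead c1, cycle 2)

For an admissible `v` with `∫_{ℝ³} v(|x|) dx < ∞` no cut-off is needed: the positive FK minimiser `Ψₙ` of the truncation
`vₙ = min(v,n)` has `𝓔_v[Ψₙ] = 𝓔_{vₙ}[Ψₙ] + ∫_cell W_{v−vₙ}|Ψₙ|² ≤ E₀(vₙ) + ‖Ψₙ‖²_∞ ∫_cell W_{v−vₙ}`, the sup norms are
bounded uniformly in `n` by `e^{E₀(v)} · pHeatConst · |cell|^{1/2}` (input I1, `stub_fkPositiveMinimiserSupBound`) and the excess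
integral tends to `0` (input I2, `stub_interactionExcess_tendsto_zero`). Registered composition node
`stub_truncationMinimisersNearOptimal_of`. Consequences (proved here): (α') on the integrable class, and — with the tree's
Faris–Simon simplicity theorem `two_mul_periodicGroundStateEnergy_lt_kyFanTwo_of_lintegral_ne_top` (Ky Fan gap of `v` itself,
every `N ≥ 1`, `L > 0`) and the clustering transfer `le_condensateOccupation_nearMinimiser_of_clustering` — the truncation transfer
of condensation for the integrable class WITHOUT (β') (`truncationTransfer_integrable_of`). [folklore; the Lean route is new]
-/

noncomputable section

namespace Summit.AtomisticToContinuum.BoseEinsteinCondensation.Cruxes.HardCoreExtension.ThirdLawCurrentFloor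

open MeasureTheory Filter
open scoped ENNReal NNReal BigOperators Topology
open Literature.MathematicalPhysics.QuantumManyBody.BoseGas
open Literature.MathematicalPhysics.QuantumManyBody

namespace AlphaInt

variable {N : ℕ} {L : ℝ}

/-! ### The excess decomposition `W_v = W_{min(v,n)} + W_{v − min(v,n)}` -/

/-- The periodisation is additive in the profile. [folklore] -/
theorem periodizedPotential_fun_add (v w : ℝ → ℝ≥0∞) (L : ℝ) (x : Space) :
    periodizedPotential (fun r => v r + w r) L x = periodizedPotential v L x + periodizedPotential w L x := by
  unfold periodizedPotential
  exact ENNReal.tsum_add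

/-- The periodic interaction is additive in the profile. [folklore] -/
theorem periodicInteraction_fun_add (v w : ℝ → ℝ≥0∞) (L : ℝ) (X : Config N) :
    periodicInteraction (fun r => v r + w r) L X = periodicInteraction v L X + periodicInteraction w L X := by
  unfold periodicInteraction
  simp only [periodizedPotential_fun_add, Finset.sum_add_distrib]

/-- `v = min(v,n) + (v − min(v,n))`. [folklore] -/
theorem trunc_add_excess (v : ℝ → ℝ≥0∞) (n : ℕ) :
    (fun r => min (v r) (n : ℝ≥0∞) + (v r - min (v r) (n : ℝ≥0∞))) = v :=
  funext fun _ => add_tsub_cancel_of_le (min_le_left _ _)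

/-- **Energy splitting**: `𝓔_v[Ψ] = 𝓔_{min(v,n)}[Ψ] + ∫_cell W_{v − min(v,n)} |Ψ|²`. [folklore] -/
theorem periodicEnergy_eq_trunc_add_excess {v : ℝ → ℝ≥0∞} (hv : Measurable v) (n : ℕ) (Ψ : PeriodicTrialState N L) :
    periodicEnergy v Ψ = periodicEnergy (fun r => min (v r) (n : ℝ≥0∞)) Ψ +
      ∫⁻ X in cellN N L, periodicInteraction (fun r => v r - min (v r) (n : ℝ≥0∞)) L X *
        ((‖Ψ.ψ X‖₊ : ℝ≥0∞)) ^ 2 := by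
  have hsplit : ∀ X : Config N, periodicInteraction v L X =
      periodicInteraction (fun r => min (v r) (n : ℝ≥0∞)) L X +
        periodicInteraction (fun r => v r - min (v r) (n : ℝ≥0∞)) L X := fun X => by
    rw [← periodicInteraction_fun_add, trunc_add_excess]
  unfold periodicEnergy
  have hmeas := measurable_energyIntegrand (N := N) (v := fun r => min (v r) (n : ℝ≥0∞)) (hv.min measurable_const) L
    Ψ.contDiff.continuous
  rw [← lintegral_add_left hmeas]
  refine lintegral_congr fun X => ?_
  rw [hsplit, add_mul, add_assoc]

/-! ### The assembly -/

/-- **(α'_int) from I1 and I2**: for an integrable admissible `v` with `E₀(v, n+1, L) < ⊤`, `L > 0`, and every `ε > 0`, all high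
truncations `vₖ` have a strictly positive real `C¹` minimiser `Ψ` with `𝓔_v[Ψ] ≤ E₀(vₖ) + ε`. [folklore] -/
theorem nearOptimal_of
    (hPM : ∀ v : ℝ → ℝ≥0∞, IsRepulsiveFiniteRange v → (∃ M : ℝ≥0∞, M ≠ ⊤ ∧ ∀ r, v r ≤ M) →
        ∀ (n : ℕ) (L : ℝ), 0 < L → ∃ Ψ : PeriodicTrialState (n + 1) L,
          periodicEnergy v Ψ = periodicGroundStateEnergy v (n + 1) L ∧ periodicEnergy v Ψ ≠ ⊤ ∧
          (∀ X, Ψ.ψ X = (‖Ψ.ψ X‖ : ℂ)) ∧ (∀ X, Ψ.ψ X ≠ 0) ∧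
          (∀ X, ((‖Ψ.ψ X‖₊ : ℝ≥0∞)) ≤
            ENNReal.ofReal (Real.exp (periodicGroundStateEnergy v (n + 1) L).toReal) *
              (pHeatConst (n + 1) L 1 * volume (cellN (n + 1) L) ^ (1 / 2 : ℝ))))
    (hexc : ∀ v : ℝ → ℝ≥0∞, IsRepulsiveFiniteRange v → (∫⁻ x : Space, v ‖x‖) ≠ ⊤ →
        ∀ (N : ℕ) (L : ℝ), 0 < L →
          Tendsto (fun n : ℕ => ∫⁻ X in cellN N L,
            periodicInteraction (fun r => v r - min (v r) (n : ℝ≥0∞)) L X) atTop (𝓝 0)) :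
    ∀ v : ℝ → ℝ≥0∞, IsRepulsiveFiniteRange v → (∫⁻ x : Space, v ‖x‖) ≠ ⊤ →
      ∀ (n : ℕ) (L : ℝ), 0 < L → periodicGroundStateEnergy v (n + 1) L ≠ ⊤ →
      ∀ ε : ℝ, 0 < ε → ∃ k₀ : ℕ, ∀ k : ℕ, k₀ ≤ k → ∃ Ψ : PeriodicTrialState (n + 1) L,
        periodicEnergy (fun r => min (v r) (k : ℝ≥0∞)) Ψ =
          periodicGroundStateEnergy (fun r => min (v r) (k : ℝ≥0∞)) (n + 1) L ∧
        periodicEnergy (fun r => min (v r) (k : ℝ≥0∞)) Ψ ≠ ⊤ ∧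
        (∀ X, Ψ.ψ X = (‖Ψ.ψ X‖ : ℂ)) ∧ (∀ X, Ψ.ψ X ≠ 0) ∧
        periodicEnergy v Ψ ≤ periodicGroundStateEnergy (fun r => min (v r) (k : ℝ≥0∞)) (n + 1) L + ENNReal.ofReal ε := by
  intro v hv hint n L hL hE ε hε
  -- the uniform sup bound `S = e^{E₀(v)} · pHeatConst · |cell|^{1/2}` and its square
  set P : ℝ≥0∞ := pHeatConst (n + 1) L 1 * volume (cellN (n + 1) L) ^ (1 / 2 : ℝ) with hP
  set S : ℝ≥0∞ := ENNReal.ofReal (Real.exp (periodicGroundStateEnergy v (n + 1) L).toReal) * P with hS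
  have hPtop : P ≠ ⊤ := by
    refine ENNReal.mul_ne_top (pHeatConst_lt_top (n + 1) hL 1).ne (ENNReal.rpow_ne_top_of_nonneg (by norm_num) ?_)
    rw [volume_cellN]; exact ENNReal.pow_ne_top (ENNReal.pow_ne_top ENNReal.ofReal_ne_top)
  have hStop : S ≠ ⊤ := ENNReal.mul_ne_top ENNReal.ofReal_ne_top hPtop
  have hS2top : S ^ 2 ≠ ⊤ := ENNReal.pow_ne_top hStop
  -- the excess integrals tend to zero, hence so does `S² · excess`
  have hT := ENNReal.Tendsto.const_mul (hexc v hv hint (n + 1) L hL) (Or.inr hS2top)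
  rw [mul_zero] at hT
  obtain ⟨k₀, hk₀⟩ := ENNReal.tendsto_atTop_zero.1 hT (ENNReal.ofReal ε) (ENNReal.ofReal_pos.2 hε)
  refine ⟨k₀, fun k hk => ?_⟩
  -- the FK minimiser of the `k`-th truncation and its sup bound
  obtain ⟨Ψ, hΨE, hΨfin, hΨreal, hΨne, hΨsup⟩ := hPM (fun r => min (v r) (k : ℝ≥0∞))
    ⟨hv.1.min measurable_const, by
      obtain ⟨R₀, hR₀⟩ := hv.2
      exact ⟨R₀, fun r hr => by simp [hR₀ r hr]⟩⟩
    ⟨k, ENNReal.natCast_ne_top k, fun r => min_le_right _ _⟩ n L hL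
  refine ⟨Ψ, hΨE, hΨfin, hΨreal, hΨne, ?_⟩
  -- `e^{E₀(vₖ)} ≤ e^{E₀(v)}`
  have hEk : periodicGroundStateEnergy (fun r => min (v r) (k : ℝ≥0∞)) (n + 1) L ≤ periodicGroundStateEnergy v (n + 1) L :=
    periodicGroundStateEnergy_mono_of_le fun r => min_le_left _ _
  have hsupS : ∀ X, ((‖Ψ.ψ X‖₊ : ℝ≥0∞)) ≤ S := fun X =>
    (hΨsup X).trans (mul_le_mul' (ENNReal.ofReal_le_ofReal (Real.exp_le_exp.2
      (ENNReal.toReal_mono hE hEk))) le_rfl)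
  -- the energy splitting and the bound on the excess term
  rw [periodicEnergy_eq_trunc_add_excess hv.1 k Ψ, hΨE]
  refine add_le_add le_rfl ?_
  calc ∫⁻ X in cellN (n + 1) L, periodicInteraction (fun r => v r - min (v r) (k : ℝ≥0∞)) L X *
          ((‖Ψ.ψ X‖₊ : ℝ≥0∞)) ^ 2
      ≤ ∫⁻ X in cellN (n + 1) L, periodicInteraction (fun r => v r - min (v r) (k : ℝ≥0∞)) L X * S ^ 2 :=
        lintegral_mono fun X => mul_le_mul' le_rfl (pow_le_pow_left' (hsupS X) 2)
    _ = S ^ 2 * ∫⁻ X in cellN (n + 1) L, periodicInteraction (fun r => v r - min (v r) (k : ℝ≥0∞)) L X := by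
        rw [lintegral_mul_const' _ _ hS2top, mul_comm]
    _ ≤ ENNReal.ofReal ε := hk₀ k hk

/-- **(α') on the integrable class** (a corollary of `nearOptimal_of`): `E₀(v) ≤ E₀(min(v,k)) + ε` for all large `k`. [folklore] -/
theorem truncationEnergyConvergence_of
    (hPM : ∀ v : ℝ → ℝ≥0∞, IsRepulsiveFiniteRange v → (∃ M : ℝ≥0∞, M ≠ ⊤ ∧ ∀ r, v r ≤ M) →
        ∀ (n : ℕ) (L : ℝ), 0 < L → ∃ Ψ : PeriodicTrialState (n + 1) L,
          periodicEnergy v Ψ = periodicGroundStateEnergy v (n + 1) L ∧ periodicEnergy v Ψ ≠ ⊤ ∧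
          (∀ X, Ψ.ψ X = (‖Ψ.ψ X‖ : ℂ)) ∧ (∀ X, Ψ.ψ X ≠ 0) ∧
          (∀ X, ((‖Ψ.ψ X‖₊ : ℝ≥0∞)) ≤
            ENNReal.ofReal (Real.exp (periodicGroundStateEnergy v (n + 1) L).toReal) *
              (pHeatConst (n + 1) L 1 * volume (cellN (n + 1) L) ^ (1 / 2 : ℝ))))
    (hexc : ∀ v : ℝ → ℝ≥0∞, IsRepulsiveFiniteRange v → (∫⁻ x : Space, v ‖x‖) ≠ ⊤ →
        ∀ (N : ℕ) (L : ℝ), 0 < L →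
          Tendsto (fun n : ℕ => ∫⁻ X in cellN N L,
            periodicInteraction (fun r => v r - min (v r) (n : ℝ≥0∞)) L X) atTop (𝓝 0)) :
    ∀ v : ℝ → ℝ≥0∞, IsRepulsiveFiniteRange v → (∫⁻ x : Space, v ‖x‖) ≠ ⊤ →
      ∀ (n : ℕ) (L : ℝ), 0 < L → periodicGroundStateEnergy v (n + 1) L ≠ ⊤ →
      ∀ ε : ℝ, 0 < ε → ∃ k₀ : ℕ, ∀ k : ℕ, k₀ ≤ k →
        periodicGroundStateEnergy v (n + 1) L ≤
          periodicGroundStateEnergy (fun r => min (v r) (k : ℝ≥0∞)) (n + 1) L + ENNReal.ofReal ε := by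
  intro v hv hint n L hL hE ε hε
  obtain ⟨k₀, hk₀⟩ := nearOptimal_of hPM hexc v hv hint n L hL hE ε hε
  refine ⟨k₀, fun k hk => ?_⟩
  obtain ⟨Ψ, -, -, -, -, hΨ⟩ := hk₀ k hk
  exact (periodicGroundStateEnergy_le v Ψ).trans hΨ

/-- **The truncation transfer of condensation on the integrable class, without (β')** : if every exact positive real
minimiser of every truncation `min(v,k)` has `n₀ ≥ cN`, then every sufficiently-near minimiser of `v` has `n₀ ≥ (c − ε)N` —
clustering of near-minimisers of `v` from the Ky Fan gap of `v` itself (Faris–Simon simplicity for `W ∈ L¹`,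
`two_mul_periodicGroundStateEnergy_lt_kyFanTwo_of_lintegral_ne_top`, + `exists_phase_integral_norm_sub_sq_le_of_kyFanGap`) and
the FK minimisers of the truncations as near-minimisers of `v` (`nearOptimal_of`), glued by
`le_condensateOccupation_nearMinimiser_of_clustering`. [folklore] -/
theorem truncationTransfer_integrable_of
    (hPM : ∀ v : ℝ → ℝ≥0∞, IsRepulsiveFiniteRange v → (∃ M : ℝ≥0∞, M ≠ ⊤ ∧ ∀ r, v r ≤ M) →
        ∀ (n : ℕ) (L : ℝ), 0 < L → ∃ Ψ : PeriodicTrialState (n + 1) L,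
          periodicEnergy v Ψ = periodicGroundStateEnergy v (n + 1) L ∧ periodicEnergy v Ψ ≠ ⊤ ∧
          (∀ X, Ψ.ψ X = (‖Ψ.ψ X‖ : ℂ)) ∧ (∀ X, Ψ.ψ X ≠ 0) ∧
          (∀ X, ((‖Ψ.ψ X‖₊ : ℝ≥0∞)) ≤
            ENNReal.ofReal (Real.exp (periodicGroundStateEnergy v (n + 1) L).toReal) *
              (pHeatConst (n + 1) L 1 * volume (cellN (n + 1) L) ^ (1 / 2 : ℝ))))
    (hexc : ∀ v : ℝ → ℝ≥0∞, IsRepulsiveFiniteRange v → (∫⁻ x : Space, v ‖x‖) ≠ ⊤ →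
        ∀ (N : ℕ) (L : ℝ), 0 < L →
          Tendsto (fun n : ℕ => ∫⁻ X in cellN N L,
            periodicInteraction (fun r => v r - min (v r) (n : ℝ≥0∞)) L X) atTop (𝓝 0)) :
    ∀ v : ℝ → ℝ≥0∞, IsRepulsiveFiniteRange v → (∫⁻ x : Space, v ‖x‖) ≠ ⊤ →
      ∀ (n : ℕ) (L : ℝ), 0 < L → periodicGroundStateEnergy v (n + 1) L ≠ ⊤ → ∀ c : ℝ,
      (∀ (k : ℕ) (Ψ : PeriodicTrialState (n + 1) L),
        periodicEnergy (fun r => min (v r) (k : ℝ≥0∞)) Ψ =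
          periodicGroundStateEnergy (fun r => min (v r) (k : ℝ≥0∞)) (n + 1) L →
        periodicEnergy (fun r => min (v r) (k : ℝ≥0∞)) Ψ ≠ ⊤ →
        (∀ X, Ψ.ψ X = (‖Ψ.ψ X‖ : ℂ)) → (∀ X, Ψ.ψ X ≠ 0) →
        ENNReal.ofReal (c * (n + 1 : ℕ)) ≤ condensateOccupation (n + 1) L Ψ.ψ) →
      ∀ ε : ℝ, 0 < ε → ∃ δ : ℝ≥0∞, 0 < δ ∧ ∀ Φ : PeriodicTrialState (n + 1) L,
        periodicEnergy v Φ ≤ periodicGroundStateEnergy v (n + 1) L + δ →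
        ENNReal.ofReal ((c - ε) * (n + 1 : ℕ)) ≤ condensateOccupation (n + 1) L Φ.ψ := by
  intro v hv hint n L hL hE c hS4 ε hε
  -- the Ky Fan gap of `v` itself
  have hlt := two_mul_periodicGroundStateEnergy_lt_kyFanTwo_of_lintegral_ne_top (Nat.le_add_left 1 n) hL hv.1 hint
  obtain ⟨γ, hγ, hgap⟩ : ∃ γ : ℝ, 0 < γ ∧
      2 * periodicGroundStateEnergy v (n + 1) L + ENNReal.ofReal γ ≤ kyFanTwo v (n + 1) L := by
    by_cases hK : kyFanTwo v (n + 1) L = ⊤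
    · exact ⟨1, one_pos, by rw [hK]; exact le_top⟩
    · have h2E : 2 * periodicGroundStateEnergy v (n + 1) L ≠ ⊤ := ENNReal.mul_ne_top ENNReal.ofNat_ne_top hE
      refine ⟨(kyFanTwo v (n + 1) L - 2 * periodicGroundStateEnergy v (n + 1) L).toReal,
        ENNReal.toReal_pos (tsub_pos_iff_lt.2 hlt).ne' (ENNReal.sub_ne_top hK), ?_⟩
      rw [ENNReal.ofReal_toReal (ENNReal.sub_ne_top hK), add_tsub_cancel_of_le hlt.le]
  -- clustering of near-minimisers of `v`
  have hcl : ∀ η : ℝ, 0 < η → ∃ δ : ℝ≥0∞, 0 < δ ∧ ∀ Φ Φ' : PeriodicTrialState (n + 1) L,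
      periodicEnergy v Φ ≤ periodicGroundStateEnergy v (n + 1) L + δ →
      periodicEnergy v Φ' ≤ periodicGroundStateEnergy v (n + 1) L + δ →
      ∃ θ : ℝ, ∫ X in cellN (n + 1) L, ‖Φ.ψ X - Complex.exp (θ * Complex.I) * Φ'.ψ X‖ ^ 2 ≤ η :=
    fun η hη => exists_phase_integral_norm_sub_sq_le_of_kyFanGap hv.1 hγ hE hgap hη
  -- near-minimisers of `v` with `n₀ ≥ cN`: the FK minimisers of the high truncations
  have hocc : ∀ δ : ℝ≥0∞, 0 < δ → ∃ Ψ : PeriodicTrialState (n + 1) L,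
      periodicEnergy v Ψ ≤ periodicGroundStateEnergy v (n + 1) L + δ ∧
      ENNReal.ofReal (c * (n + 1 : ℕ)) ≤ condensateOccupation (n + 1) L Ψ.ψ := by
    intro δ hδ
    -- a real `ε' > 0` below `δ`
    obtain ⟨ε', hε', hε'δ⟩ : ∃ ε' : ℝ, 0 < ε' ∧ ENNReal.ofReal ε' ≤ δ := by
      rcases eq_or_ne δ ⊤ with h | h
      · exact ⟨1, one_pos, h ▸ le_top⟩
      · exact ⟨δ.toReal, ENNReal.toReal_pos hδ.ne' h, (ENNReal.ofReal_toReal h).le⟩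
    obtain ⟨k₀, hk₀⟩ := nearOptimal_of hPM hexc v hv hint n L hL hE ε' hε'
    obtain ⟨Ψ, h₁, h₂, h₃, h₄, hΨv⟩ := hk₀ k₀ le_rfl
    have hEk : periodicGroundStateEnergy (fun r => min (v r) (k₀ : ℝ≥0∞)) (n + 1) L ≤
        periodicGroundStateEnergy v (n + 1) L := periodicGroundStateEnergy_mono_of_le fun r => min_le_left _ _
    exact ⟨Ψ, hΨv.trans (add_le_add hEk hε'δ), hS4 k₀ Ψ h₁ h₂ h₃ h₄⟩
  have h := le_condensateOccupation_nearMinimiser_of_clustering hL v hcl (c := c) hocc hε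
  exact h

end AlphaInt

open AlphaInt

/-- **Registered composition node `stub_truncationMinimisersNearOptimal_of`** (= `AlphaInt.nearOptimal_of` with the two inputs I1,
I2 as antecedents): on the integrable class the FK minimisers of the high truncations are `ε`-near-minimisers of `v`. [folklore] -/
theorem stub_truncationMinimisersNearOptimal_of :
    (∀ v : ℝ → ℝ≥0∞, IsRepulsiveFiniteRange v → (∃ M : ℝ≥0∞, M ≠ ⊤ ∧ ∀ r, v r ≤ M) →
      ∀ (n : ℕ) (L : ℝ), 0 < L → ∃ Ψ : PeriodicTrialState (n + 1) L,
        periodicEnergy v Ψ = periodicGroundStateEnergy v (n + 1) L ∧ periodicEnergy v Ψ ≠ ⊤ ∧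
        (∀ X, Ψ.ψ X = (‖Ψ.ψ X‖ : ℂ)) ∧ (∀ X, Ψ.ψ X ≠ 0) ∧
        (∀ X, ((‖Ψ.ψ X‖₊ : ℝ≥0∞)) ≤
          ENNReal.ofReal (Real.exp (periodicGroundStateEnergy v (n + 1) L).toReal) *
            (pHeatConst (n + 1) L 1 * volume (cellN (n + 1) L) ^ (1 / 2 : ℝ)))) →
    (∀ v : ℝ → ℝ≥0∞, IsRepulsiveFiniteRange v → (∫⁻ x : Space, v ‖x‖) ≠ ⊤ →
      ∀ (N : ℕ) (L : ℝ), 0 < L →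
        Tendsto (fun n : ℕ => ∫⁻ X in cellN N L,
          periodicInteraction (fun r => v r - min (v r) (n : ℝ≥0∞)) L X) atTop (𝓝 0)) →
    ∀ v : ℝ → ℝ≥0∞, IsRepulsiveFiniteRange v → (∫⁻ x : Space, v ‖x‖) ≠ ⊤ →
      ∀ (n : ℕ) (L : ℝ), 0 < L → periodicGroundStateEnergy v (n + 1) L ≠ ⊤ →
      ∀ ε : ℝ, 0 < ε → ∃ k₀ : ℕ, ∀ k : ℕ, k₀ ≤ k → ∃ Ψ : PeriodicTrialState (n + 1) L,
        periodicEnergy (fun r => min (v r) (k : ℝ≥0∞)) Ψ =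
          periodicGroundStateEnergy (fun r => min (v r) (k : ℝ≥0∞)) (n + 1) L ∧
        periodicEnergy (fun r => min (v r) (k : ℝ≥0∞)) Ψ ≠ ⊤ ∧
        (∀ X, Ψ.ψ X = (‖Ψ.ψ X‖ : ℂ)) ∧ (∀ X, Ψ.ψ X ≠ 0) ∧
        periodicEnergy v Ψ ≤ periodicGroundStateEnergy (fun r => min (v r) (k : ℝ≥0∞)) (n + 1) L + ENNReal.ofReal ε :=
  fun hPM hexc => AlphaInt.nearOptimal_of hPM hexc

end Summit.AtomisticToContinuum.BoseEinsteinCondensation.Cruxes.HardCoreExtension.ThirdLawCurrentFloor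

end
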